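import Summits.KontsevichZagierPeriods.KontsevichZagierPeriods.Theorems.SoloInformedPathHomotopyPrep
import HarnessLib
import HarnessLib.Audit

/-!
# SoloInformed — point and segment generators of rational one-dimensional periods

Solo programme `solo-KontsevichZagierPeriods-informed`, session s112 (kernel project
«`SoloInformedKZPUpTo 1` unconditionally from the tree's kernel Baker theorem»), file 3.

The two kinds of generators every rational representation of dimension `≤ 1` reduces to:

* the POINT representation `soloInformedPtRep a = [pt, a]` (`a ∈ ℚ̄ ∩ ℝ`), value `a`;
* the SEGMENT representation `soloInformedSegRep g c = [[0,1], Re(g (c − 1)/(1 + (c − 1)s))]`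
  for ADMISSIBLE data (`SoloInformedSegAdm g c`: `g, c ∈ ℚ̄`, `c ∉ (−∞, 0]`): the real part of
  `g · dlog` along the straight path `L_c(s) = 1 + (c − 1)s` from `1` to `c`; its value is
  `Re(g · Log c)` (`soloInformed_value_segRep`, principal branch).  For inadmissible data the
  definition returns the zero representation on `[0,1]` (a harmless junk value).

Proved here: domain/integrand/value lemmas, `ℤ`-linearity in `g` modulo `KZ.relations`
(`soloInformed_segRep_add/neg/zsmul_sub_mem_relations`), vanishing at `c = 1`, and the conjugation
symmetry `soloInformedSegRep (conj g) (conj c) = soloInformedSegRep g c` (same integrand) that lets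
the real relation `Σ Re(gₖ Log cₖ) = 0` be complexified for Baker's theorem.

References: M. Kontsevich, D. Zagier, *Periods* (2001), §1.1–§1.2; A. Baker, *Transcendental
Number Theory* (1975), Ch. 2 (consumer, file `SoloInformedSegBaker`).
-/

noncomputable section

open scoped BigOperators Polynomial ComplexConjugate
open MeasureTheory Set Filter
open Literature.ModelTheory.ExponentialFields
open Literature.NumberTheory.Transcendental Literature.NumberTheory.Transcendental.KZ

namespace Summit.KontsevichZagierPeriods.KontsevichZagierPeriods.Theorems

/-! ### Point representations -/

/-- **The point representation `[pt, a]`** (`a` real algebraic): domain `ℝ⁰`, integrand `a`.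
(The same object as `soloInformedPtRep` of `SoloInformedKZAlgebra`, re-introduced here to keep
this file's import closure inside the currently built part of the tree.)
[Kontsevich–Zagier 2001, §1.1] -/
def soloInformedPtRep (a : ℝ) (ha : IsAlgebraic ℚ a) : IntegralRep 0 where
  domain := univ
  integrand := fun _ => a
  isSemialgebraic_domain := isSemialgebraic_univ
  isSemialgebraicFunOn_integrand := isSemialgebraicFunOn_const_of_isAlgebraic isSemialgebraic_univ ha
  integrableOn := integrableOn_const (hs := by rw [volume_pi, Measure.pi_univ]; simp)

/-- Domain of `[pt, a]`. -/
@[simp] theorem soloInformed_ptRep_domain (a : ℝ) (ha : IsAlgebraic ℚ a) :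
    (soloInformedPtRep a ha).domain = univ := rfl

/-- Integrand of `[pt, a]`. -/
@[simp] theorem soloInformed_ptRep_integrand (a : ℝ) (ha : IsAlgebraic ℚ a) :
    (soloInformedPtRep a ha).integrand = fun _ => a := rfl

/-- `value [pt, a] = a`. -/
@[simp] theorem soloInformed_value_ptRep (a : ℝ) (ha : IsAlgebraic ℚ a) :
    (soloInformedPtRep a ha).value = a := by
  have hv : volume (univ : Set (Fin 0 → ℝ)) = 1 := by rw [volume_pi, Measure.pi_univ]; simp
  simp [IntegralRep.value, Measure.restrict_univ, measureReal_def, hv]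

/-- `[pt, a + b] − [pt, a] − [pt, b]` is a relation (integrand additivity). -/
theorem soloInformed_ptRep_add_sub_mem_relations {a b : ℝ} (ha : IsAlgebraic ℚ a)
    (hb : IsAlgebraic ℚ b) :
    of (soloInformedPtRep (a + b) (ha.add hb)) - of (soloInformedPtRep a ha) -
      of (soloInformedPtRep b hb) ∈ relations :=
  integrandAddRel_subset_relations ⟨0, soloInformedPtRep (a + b) (ha.add hb),
    soloInformedPtRep a ha, soloInformedPtRep b hb, rfl, rfl, fun _ _ => rfl, rfl⟩

/-- `[pt, −a] + [pt, a]` is a relation. -/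
theorem soloInformed_ptRep_neg_add_mem_relations {a : ℝ} (ha : IsAlgebraic ℚ a) :
    of (soloInformedPtRep (-a) ha.neg) + of (soloInformedPtRep a ha) ∈ relations := by
  rw [add_comm]
  exact of_add_of_mem_relations_of_eqOn_neg rfl fun _ _ => rfl

/-- `[pt, 0]` is a relation. -/
theorem soloInformed_ptRep_zero_mem_relations :
    of (soloInformedPtRep 0 isAlgebraic_zero) ∈ relations :=
  of_mem_relations_of_eqOn_zero _ fun _ _ => rfl

/-- Two point representations with the same constant differ by a relation (proof irrelevance
made explicit for rewriting the constant). -/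
theorem soloInformed_ptRep_congr_sub_mem_relations {a b : ℝ} (ha : IsAlgebraic ℚ a)
    (hb : IsAlgebraic ℚ b) (h : a = b) :
    of (soloInformedPtRep a ha) - of (soloInformedPtRep b hb) ∈ relations := by
  subst h
  simp

/-! ### The straight path `L_c(s) = 1 + (c − 1)s` -/

/-- For `c ∉ (−∞,0]` and `s ∈ [0,1]` the point `1 + (c − 1)s = (1 − s) + s c` lies off `(−∞,0]`
(the slit plane is star-shaped about `1`). -/
theorem soloInformed_seg_mem_slitPlane {c : ℂ} (hc : c ∈ Complex.slitPlane) {s : ℝ}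
    (hs : s ∈ Icc (0 : ℝ) 1) : 1 + (c - 1) * (s : ℂ) ∈ Complex.slitPlane := by
  rw [Complex.mem_slitPlane_iff] at hc ⊢
  have hre : (1 + (c - 1) * (s : ℂ)).re = (1 - s) + c.re * s := by simp; ring
  have him : (1 + (c - 1) * (s : ℂ)).im = c.im * s := by simp
  rw [hre, him]
  obtain ⟨h0, h1⟩ := hs
  rcases eq_or_lt_of_le h0 with rfl | hpos
  · left; simp
  rcases hc with hc | hc
  · left; nlinarith
  · right; exact mul_ne_zero hc hpos.ne'

/-- … in particular it is non-zero. -/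
theorem soloInformed_seg_ne_zero {c : ℂ} (hc : c ∈ Complex.slitPlane) {s : ℝ}
    (hs : s ∈ Icc (0 : ℝ) 1) : 1 + (c - 1) * (s : ℂ) ≠ 0 :=
  Complex.slitPlane_ne_zero (soloInformed_seg_mem_slitPlane hc hs)

/-! ### Segment representations -/

/-- Admissible segment data: `g, c` algebraic and `c` off the closed negative real axis. -/
def SoloInformedSegAdm (g c : ℂ) : Prop :=
  IsAlgebraic ℚ g ∧ IsAlgebraic ℚ c ∧ c ∈ Complex.slitPlane

/-- The segment integrand `s ↦ Re(g (c − 1)/(1 + (c − 1)s))` on `ℝ¹` (coordinate `y 0 = s`). -/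
def soloInformedSegFun (g c : ℂ) (y : Fin 1 → ℝ) : ℝ :=
  (g * ((c - 1) / (1 + (c - 1) * ((y 0 : ℝ) : ℂ)))).re

/-- The coordinate is semialgebraic on the unit band. -/
theorem soloInformed_isSemialgebraicFunOn_unitBand_coord :
    IsSemialgebraicFunOn ℚ soloInformedUnitBand (fun y => y 0) :=
  (isSemialgebraicFunOn_aeval soloInformed_isSemialgebraic_unitBand (MvPolynomial.X 0)).congr
    fun y _ => by simp

/-- The segment integrand is semialgebraic on `[0,1]` for algebraic data. -/
theorem soloInformed_isSemialgebraicFunOn_segFun {g c : ℂ} (hg : IsAlgebraic ℚ g)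
    (hc : IsAlgebraic ℚ c) (hc' : c ∈ Complex.slitPlane) :
    IsSemialgebraicFunOn ℚ soloInformedUnitBand (soloInformedSegFun g c) := by
  have hI := soloInformed_isSemialgebraic_unitBand
  have hc1 := isAlgebraic_re_im (hc.sub isAlgebraic_one)
  have hne : ∀ y ∈ soloInformedUnitBand, 1 + (c - 1) * ((y 0 : ℝ) : ℂ) ≠ 0 := fun y hy =>
    soloInformed_seg_ne_zero hc' (soloInformed_mem_unitBand.1 hy)
  have h1 : IsSemialgebraicFunOn ℚ soloInformedUnitBand (fun _ => (1 : ℂ).re) ∧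
      IsSemialgebraicFunOn ℚ soloInformedUnitBand (fun _ => (1 : ℂ).im) :=
    re_im_const hI (by simpa using isAlgebraic_one) (by simpa using isAlgebraic_zero)
  unfold soloInformedSegFun
  exact (re_im_mul (re_im_const hI (isAlgebraic_re_im hg).1 (isAlgebraic_re_im hg).2)
    (re_im_div (re_im_const hI hc1.1 hc1.2) (re_im_add h1 (re_im_mul (re_im_const hI hc1.1 hc1.2)
      (re_im_ofReal hI soloInformed_isSemialgebraicFunOn_unitBand_coord))) hne)).1

/-- The unit band is the order interval `[0,1]` of `ℝ¹`. -/
theorem soloInformed_unitBand_eq_Icc : soloInformedUnitBand = Icc (0 : Fin 1 → ℝ) 1 := by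
  ext y
  rw [soloInformed_mem_unitBand, mem_Icc, Pi.le_def, Pi.le_def, Fin.forall_fin_one,
    Fin.forall_fin_one]
  rfl

/-- The unit band is compact. -/
theorem soloInformed_isCompact_unitBand : IsCompact soloInformedUnitBand := by
  rw [soloInformed_unitBand_eq_Icc]
  exact isCompact_Icc

/-- The segment integrand is continuous on `[0,1]` (`c ∉ (−∞,0]`). -/
theorem soloInformed_continuousOn_segFun (g : ℂ) {c : ℂ} (hc' : c ∈ Complex.slitPlane) :
    ContinuousOn (soloInformedSegFun g c) soloInformedUnitBand := by
  have hne : ∀ y ∈ soloInformedUnitBand, 1 + (c - 1) * ((y 0 : ℝ) : ℂ) ≠ 0 := fun y hy =>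
    soloInformed_seg_ne_zero hc' (soloInformed_mem_unitBand.1 hy)
  have hden : Continuous fun y : Fin 1 → ℝ => 1 + (c - 1) * ((y 0 : ℝ) : ℂ) :=
    continuous_const.add (continuous_const.mul (Complex.continuous_ofReal.comp
      (continuous_apply 0)))
  unfold soloInformedSegFun
  exact Complex.continuous_re.comp_continuousOn
    (continuousOn_const.mul (continuousOn_const.div hden.continuousOn hne))

open scoped Classical in
/-- **The segment representation** `[[0,1], Re(g (c − 1)/(1 + (c − 1)s))]` for admissible data,
the zero representation on `[0,1]` otherwise. [Kontsevich–Zagier 2001, §1.1; this work] -/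
def soloInformedSegRep (g c : ℂ) : IntegralRep 1 :=
  if h : SoloInformedSegAdm g c then
    ⟨soloInformedUnitBand, soloInformedSegFun g c, soloInformed_isSemialgebraic_unitBand,
      soloInformed_isSemialgebraicFunOn_segFun h.1 h.2.1 h.2.2,
      (soloInformed_continuousOn_segFun g h.2.2).integrableOn_compact
        soloInformed_isCompact_unitBand⟩
  else
    ⟨soloInformedUnitBand, fun _ => 0, soloInformed_isSemialgebraic_unitBand,
      soloInformed_isSemialgebraicFunOn_zero_unitBand, integrableOn_zero⟩

/-- Domain of a segment representation. -/
@[simp] theorem soloInformed_segRep_domain (g c : ℂ) :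
    (soloInformedSegRep g c).domain = soloInformedUnitBand := by
  unfold soloInformedSegRep
  split_ifs <;> rfl

/-- Integrand of an admissible segment representation. -/
theorem soloInformed_segRep_integrand {g c : ℂ} (h : SoloInformedSegAdm g c) :
    (soloInformedSegRep g c).integrand = soloInformedSegFun g c := by
  unfold soloInformedSegRep
  rw [dif_pos h]

/-- Integrand of an inadmissible segment representation. -/
theorem soloInformed_segRep_integrand_of_not {g c : ℂ} (h : ¬ SoloInformedSegAdm g c) :
    (soloInformedSegRep g c).integrand = fun _ => 0 := by
  unfold soloInformedSegRep
  rw [dif_neg h]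

/-- An inadmissible segment representation is a relation. -/
theorem soloInformed_segRep_mem_relations_of_not {g c : ℂ} (h : ¬ SoloInformedSegAdm g c) :
    of (soloInformedSegRep g c) ∈ relations :=
  of_mem_relations_of_eqOn_zero _ fun y _ => by rw [soloInformed_segRep_integrand_of_not h]; rfl

open scoped Classical in
/-- Pointwise form of the integrand (both branches of the definition). -/
theorem soloInformed_segRep_integrand_apply (g c : ℂ) (y : Fin 1 → ℝ) :
    (soloInformedSegRep g c).integrand y =
      if SoloInformedSegAdm g c then soloInformedSegFun g c y else 0 := by
  split_ifs with h
  · rw [soloInformed_segRep_integrand h]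
  · rw [soloInformed_segRep_integrand_of_not h]

/-- The segment to `c = 1` is a relation (zero integrand). -/
theorem soloInformed_segRep_one_mem_relations (g : ℂ) :
    of (soloInformedSegRep g 1) ∈ relations :=
  of_mem_relations_of_eqOn_zero _ fun y _ => by
    rw [soloInformed_segRep_integrand_apply]
    split_ifs
    · simp [soloInformedSegFun]
    · rfl

/-- **Value of a segment representation**: `∫₀¹ Re(g (c−1)/(1+(c−1)s)) ds = Re(g · Log c)`
(fundamental theorem of calculus with primitive `Re(g · Log(1 + (c−1)s))`, principal branch,
the path staying off `(−∞,0]`). [folklore] -/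
theorem soloInformed_value_segRep {g c : ℂ} (h : SoloInformedSegAdm g c) :
    (soloInformedSegRep g c).value = (g * Complex.log c).re := by
  have hc' := h.2.2
  set G : ℝ → ℝ := fun t => (g * ((c - 1) / (1 + (c - 1) * (t : ℂ)))).re with hG
  set F : ℝ → ℝ := fun t => (g * Complex.log (1 + (c - 1) * (t : ℂ))).re with hF
  have hmp : MeasurePreserving (MeasurableEquiv.funUnique (Fin 1) ℝ) volume volume :=
    volume_preserving_funUnique (Fin 1) ℝ
  have hset : soloInformedUnitBand = (MeasurableEquiv.funUnique (Fin 1) ℝ) ⁻¹' Icc 0 1 := by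
    ext z
    simp [soloInformed_mem_unitBand, MeasurableEquiv.funUnique]
  have h1 : (soloInformedSegRep g c).value = ∫ t in Icc (0 : ℝ) 1, G t := by
    rw [IntegralRep.value, soloInformed_segRep_domain, soloInformed_segRep_integrand h, hset,
      ← hmp.setIntegral_preimage_emb (MeasurableEquiv.funUnique (Fin 1) ℝ).measurableEmbedding
        G (Icc 0 1)]
    rfl
  have hder : ∀ t ∈ Icc (0 : ℝ) 1, HasDerivAt F (G t) t := by
    intro t ht
    have hmem := soloInformed_seg_mem_slitPlane hc' ht
    have hd : HasDerivAt (fun τ : ℂ => 1 + (c - 1) * τ) ((c - 1) * 1) (t : ℂ) :=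
      ((hasDerivAt_id' (t : ℂ)).const_mul (c - 1)).const_add 1
    have := ((hd.clog hmem).const_mul g).real_of_complex
    simpa [hF, hG] using this
  have hden : Continuous fun t : ℝ => 1 + (c - 1) * (t : ℂ) :=
    continuous_const.add (continuous_const.mul Complex.continuous_ofReal)
  have hGc : ContinuousOn G (Icc 0 1) :=
    Complex.continuous_re.comp_continuousOn (continuousOn_const.mul
      (continuousOn_const.div hden.continuousOn fun t ht => soloInformed_seg_ne_zero hc' ht))
  have h2 : ∫ t in (0 : ℝ)..1, G t = F 1 - F 0 :=
    intervalIntegral.integral_eq_sub_of_hasDerivAt (by rwa [uIcc_of_le zero_le_one])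
      (hGc.intervalIntegrable_of_Icc zero_le_one)
  rw [h1, integral_Icc_eq_integral_Ioc, ← intervalIntegral.integral_of_le zero_le_one, h2]
  simp [hF]

/-! ### Linearity in `g` modulo relations -/

/-- `Seg(g₁ + g₂, c) − Seg(g₁, c) − Seg(g₂, c)` is a relation. -/
theorem soloInformed_segRep_add_sub_mem_relations {g₁ g₂ : ℂ} (hg₁ : IsAlgebraic ℚ g₁)
    (hg₂ : IsAlgebraic ℚ g₂) (c : ℂ) :
    of (soloInformedSegRep (g₁ + g₂) c) - of (soloInformedSegRep g₁ c) -
      of (soloInformedSegRep g₂ c) ∈ relations := by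
  by_cases hc : IsAlgebraic ℚ c ∧ c ∈ Complex.slitPlane
  · refine integrandAddRel_subset_relations ⟨1, _, _, _, by simp, by simp, fun y _ => ?_, rfl⟩
    simp only [Pi.add_apply, soloInformed_segRep_integrand ⟨hg₁.add hg₂, hc⟩,
      soloInformed_segRep_integrand ⟨hg₁, hc⟩, soloInformed_segRep_integrand ⟨hg₂, hc⟩,
      soloInformedSegFun, add_mul, Complex.add_re]
  · have h0 : ∀ g, ¬ SoloInformedSegAdm g c := fun g hg => hc hg.2
    exact relations.sub_mem (relations.sub_mem (soloInformed_segRep_mem_relations_of_not (h0 _))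
      (soloInformed_segRep_mem_relations_of_not (h0 _)))
      (soloInformed_segRep_mem_relations_of_not (h0 _))

/-- `Seg(−g, c) + Seg(g, c)` is a relation. -/
theorem soloInformed_segRep_neg_add_mem_relations {g : ℂ} (hg : IsAlgebraic ℚ g) (c : ℂ) :
    of (soloInformedSegRep (-g) c) + of (soloInformedSegRep g c) ∈ relations := by
  by_cases hc : IsAlgebraic ℚ c ∧ c ∈ Complex.slitPlane
  · rw [add_comm]
    refine of_add_of_mem_relations_of_eqOn_neg (by simp) fun y _ => ?_
    simp only [Pi.neg_apply, soloInformed_segRep_integrand ⟨hg.neg, hc⟩,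
      soloInformed_segRep_integrand ⟨hg, hc⟩, soloInformedSegFun, neg_mul, Complex.neg_re]
  · have h0 : ∀ g, ¬ SoloInformedSegAdm g c := fun g hg => hc hg.2
    exact relations.add_mem (soloInformed_segRep_mem_relations_of_not (h0 _))
      (soloInformed_segRep_mem_relations_of_not (h0 _))

/-- `Seg(0, c)` is a relation. -/
theorem soloInformed_segRep_zero_mem_relations (c : ℂ) :
    of (soloInformedSegRep 0 c) ∈ relations :=
  of_mem_relations_of_eqOn_zero _ fun y _ => by
    rw [soloInformed_segRep_integrand_apply]
    split_ifs
    · simp [soloInformedSegFun]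
    · rfl

/-- `n • Seg(g, c) − Seg(n g, c)` is a relation (`n ∈ ℤ`). -/
theorem soloInformed_segRep_zsmul_sub_mem_relations {g : ℂ} (hg : IsAlgebraic ℚ g) (c : ℂ)
    (n : ℤ) : n • of (soloInformedSegRep g c) - of (soloInformedSegRep (n * g) c) ∈ relations := by
  induction n using Int.induction_on with
  | zero => simpa using relations.neg_mem (soloInformed_segRep_zero_mem_relations c)
  | succ n ih =>
    have hn : IsAlgebraic ℚ (((n : ℤ) : ℂ) * g) := (isAlgebraic_int (n : ℤ)).mul hg
    have h := soloInformed_segRep_add_sub_mem_relations hn hg c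
    have hA : (((n : ℤ) + 1 : ℤ) : ℂ) * g = ((n : ℤ) : ℂ) * g + g := by push_cast; ring
    have key : ((n : ℤ) + 1) • of (soloInformedSegRep g c) -
        of (soloInformedSegRep (((n : ℤ) : ℂ) * g + g) c) =
        (n : ℤ) • of (soloInformedSegRep g c) - of (soloInformedSegRep (((n : ℤ) : ℂ) * g) c) -
          (of (soloInformedSegRep (((n : ℤ) : ℂ) * g + g) c) -
            of (soloInformedSegRep (((n : ℤ) : ℂ) * g) c) - of (soloInformedSegRep g c)) := by
      simp only [add_smul, one_smul]; abel
    rw [hA, key]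
    exact relations.sub_mem ih h
  | pred n ih =>
    have hn : IsAlgebraic ℚ (((-(n : ℤ) : ℤ) : ℂ) * g) := (isAlgebraic_int (-(n : ℤ))).mul hg
    have h := soloInformed_segRep_add_sub_mem_relations hn hg.neg c
    have h' := soloInformed_segRep_neg_add_mem_relations hg c
    have hA : ((-(n : ℤ) - 1 : ℤ) : ℂ) * g = ((-(n : ℤ) : ℤ) : ℂ) * g + -g := by push_cast; ring
    have key : (-(n : ℤ) - 1) • of (soloInformedSegRep g c) -
        of (soloInformedSegRep (((-(n : ℤ) : ℤ) : ℂ) * g + -g) c) =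
        (-(n : ℤ)) • of (soloInformedSegRep g c) - of (soloInformedSegRep (((-(n : ℤ) : ℤ) : ℂ) * g) c)
          - (of (soloInformedSegRep (((-(n : ℤ) : ℤ) : ℂ) * g + -g) c) -
            of (soloInformedSegRep (((-(n : ℤ) : ℤ) : ℂ) * g) c) - of (soloInformedSegRep (-g) c))
          - (of (soloInformedSegRep (-g) c) + of (soloInformedSegRep g c)) := by
      simp only [sub_smul, neg_smul, one_smul]; abel
    rw [hA, key]
    exact relations.sub_mem (relations.sub_mem ih h) h'

/-! ### Conjugation symmetry -/

/-- The conjugate of an algebraic complex number is algebraic (`conj z = 2 Re z − z`). -/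
theorem soloInformed_isAlgebraic_conj_iff {z : ℂ} : IsAlgebraic ℚ (conj z) ↔ IsAlgebraic ℚ z := by
  have key : ∀ w : ℂ, IsAlgebraic ℚ w → IsAlgebraic ℚ (conj w) := fun w hw => by
    have hre : IsAlgebraic ℚ ((w.re : ℝ) : ℂ) := by
      simpa using ((isAlgebraic_re_im hw).1).algebraMap (A := ℂ)
    have h2 : IsAlgebraic ℚ (2 : ℂ) := by simpa using isAlgebraic_nat (R := ℚ) (A := ℂ) 2
    have h : conj w = 2 * ((w.re : ℝ) : ℂ) - w := Complex.ext (by simp; ring) (by simp)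
    rw [h]
    exact (h2.mul hre).sub hw
  exact ⟨fun h => by simpa using key _ h, key z⟩

/-- Admissibility is invariant under conjugation. -/
theorem soloInformed_segAdm_conj_iff (g c : ℂ) :
    SoloInformedSegAdm (conj g) (conj c) ↔ SoloInformedSegAdm g c := by
  have hsp : ∀ z : ℂ, conj z ∈ Complex.slitPlane ↔ z ∈ Complex.slitPlane := fun z => by
    simp [Complex.mem_slitPlane_iff]
  constructor
  · rintro ⟨hg, hc, hc'⟩
    exact ⟨soloInformed_isAlgebraic_conj_iff.1 hg,
      soloInformed_isAlgebraic_conj_iff.1 hc, (hsp c).1 hc'⟩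
  · rintro ⟨hg, hc, hc'⟩
    exact ⟨soloInformed_isAlgebraic_conj_iff.2 hg, soloInformed_isAlgebraic_conj_iff.2 hc,
      (hsp c).2 hc'⟩

/-- The segment integrand is invariant under simultaneous conjugation of `g` and `c`. -/
theorem soloInformed_segFun_conj (g c : ℂ) :
    soloInformedSegFun (conj g) (conj c) = soloInformedSegFun g c := by
  funext y
  unfold soloInformedSegFun
  have : conj g * ((conj c - 1) / (1 + (conj c - 1) * ((y 0 : ℝ) : ℂ))) =
      conj (g * ((c - 1) / (1 + (c - 1) * ((y 0 : ℝ) : ℂ)))) := by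
    simp [map_div₀, Complex.conj_ofReal]
  rw [this, Complex.conj_re]

/-- **Conjugation symmetry**: `Seg(ḡ, c̄) = Seg(g, c)` as representations. -/
theorem soloInformed_segRep_conj (g c : ℂ) :
    soloInformedSegRep (conj g) (conj c) = soloInformedSegRep g c := by
  by_cases h : SoloInformedSegAdm g c
  · have h' := (soloInformed_segAdm_conj_iff g c).2 h
    unfold soloInformedSegRep
    rw [dif_pos h, dif_pos h']
    simp only [soloInformed_segFun_conj]
  · have h' : ¬ SoloInformedSegAdm (conj g) (conj c) := fun h'' =>
      h ((soloInformed_segAdm_conj_iff g c).1 h'')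
    unfold soloInformedSegRep
    rw [dif_neg h, dif_neg h']

end Summit.KontsevichZagierPeriods.KontsevichZagierPeriods.Theorems
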